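import Summits.CriticalPhenomena.PercolationContinuityZ3.Theorems.Transplant.SiteStarHPrelim
import HarnessLib

/-!
# SITE percolation: Lemma (★^H)_site — the one-source bound of the conditioned slack hierarchy with a marker SET `S ∋ x`, and its
# corollary `Y^H ≤ H`, in finitary form (WP3 step 2 of P1-SITE-Z3 §16; site twin of `Theorems/PercNearOneGluingNoHeavyLowerTailCovTauStarH.lean`)

builds on p205010 (kernel theorem, internal audit signed; external expert review pending).

For a world `D : Finset V` with vertex weights `p`, a source set `N`, an owner `x ∈ S` (marker set `S`), an observer `v` and a monotone
nonnegative vertex-cluster functional `g`, with `H(W) = Cov(g(C^W_x), 1{v ↔ S in W})` (`SiteStarH.covS`) and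
`Y^H(N) = E[ H(D ∖ S_N) ; x ∉ C_N ]` (`SiteStarH.yS`; `S_N` = sources ∪ cluster ∪ vertex boundary, the set revealed by the site exploration):
* `yS_eq_sub` — the law of total covariance along the site exploration `ℱ_N` (Markov bookkeeping `starS_markov` + tower property);
* **`starS_ED`** — (★^H)_site: `Y^H(N) · P(v ↮ S) ≤ P(v ↮ S, v ↮ N) · H(D)` (decision-tree Harris for `E[g(C_x) | ℱ_N]` and `{v ↔ S ∪ N}`
  [Gladkov 2024, Thm 3.2, generic layer `TreeHarris.treeHarris_real`] + SITE vdBHK Thm 1.4 with the set `S` (`bhk14S_ED`));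
* **`yS_le_covS`** — `Y^H(N) ≤ H(D)` (decision-tree Harris alone).
OURS (the printed inequalities are bond-only); unlike the bond file no hypothesis `v ∉ S` is needed.  The META-A2 vocabulary
(`SiteCovTau.Yw/Mav/BfS`, hypotheses `hstar`/`hYB` of `SiteCovTau.a2H_of_star` and `siteHpart_nonneg_of_star`) is served by the bridge file
`SiteStarBridge.lean`.  Support file (`--supports stmt-CriticalPhenomena-4575 --as helper`); no definitions, no named facts, no sorries.
[cite: Gladkov2024, Thm. 3.2 (p. 4), Lemma 3.1] [cite: VandenbergHaggstromKahn2005, Thm. 1.4 (p. 7) with Remark 1 (p. 5), eq. (6) (p. 4)]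
-/

noncomputable section

open Classical

namespace Summit.CriticalPhenomena.PercolationContinuityZ3.Theorems.Transplant

namespace SiteStarH

open Finset MeasureTheory
open Literature.Probability.Percolation
open Literature.Probability.Percolation.DecisionTree
open SiteBHK (sC sD mem_sC_comm sC_mono)
open SiteSetExploration
open TreeHarris
open CovTauStarN (ED_congr_on ED_sub cE_mul_of_local_on cE_cE)

variable {V : Type*} [Fintype V] [DecidableEq V] {Γ : SimpleGraph V}

/-! ### The law of total covariance along the site exploration -/

section Main

variable (D : Finset V) (p : V → ℝ) (N : Finset V) (x v : V) (S : Finset V) (g : Set V → ℝ)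

omit [Fintype V] in
/-- **`Y^H(N) = E[g(C_x)·1{v↔S}] − E[ E[g(C_x) | ℱ_N] · 1{v↔S} ]`** (site): the law of total covariance along the site exploration `ℱ_N` of
the cluster of `N` — on `{x ∈ C_N}` the owner's functional is decided, on `{x ∉ C_N, v ∈ C_N}` the indicator `1{v ↔ S}` is decided and the
world covariance vanishes, on `{x, v ∉ C_N}` the hybrid is the site world `D ∖ S_N` (`starS_markov`); then the tower property
`E[cE f · cE h] = E[cE f · h]`. [cite: Gladkov2024, Lemma 3.1 (p. 4)] [cite: VandenbergHaggstromKahn2005, eq. (6) (p. 4)] -/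
theorem yS_eq_sub : yS Γ D p g x S v N = ED D p (fun K => fS Γ D g x K * nS Γ D S v K) -
    ED D p (fun K => cE D p (revealedAt Γ D N) (fS Γ D g x) K * nS Γ D S v K) := by
  have hSD : SelfDetermined (revealedAt Γ D N) := selfDetermined_revealedAt
  have hY : yS Γ D p g x S v N = ED D p (fun K => fS Γ D g x K * nS Γ D S v K) -
      ED D p (fun K => cE D p (revealedAt Γ D N) (fS Γ D g x) K * cE D p (revealedAt Γ D N) (nS Γ D S v) K) := by
    unfold yS
    rw [← ED_cE D p hSD (fun K => fS Γ D g x K * nS Γ D S v K), ← ED_sub]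
    refine ED_congr_on D p fun K _ => ?_
    have hM := fun K₂ (_ : K₂ ∈ D.powerset) => starS_markov (Γ := Γ) (D := D) (N := N) x v S g K K₂
    by_cases hx : x ∈ reached Γ D N K
    · -- the owner's functional is decided: pull it out
      rw [ind_of_not_mem (show K ∉ {L : Finset V | x ∉ reached Γ D N L} from fun h' => h' hx), zero_mul]
      have e1 : cE D p (revealedAt Γ D N) (fun L => fS Γ D g x L * nS Γ D S v L) K =
          fS Γ D g x K * cE D p (revealedAt Γ D N) (nS Γ D S v) K :=
        cE_mul_of_local_on D p (revealedAt Γ D N) (fun K₂ hK₂ => (hM K₂ hK₂).1 hx) (nS Γ D S v)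
      have e2 : cE D p (revealedAt Γ D N) (fS Γ D g x) K = fS Γ D g x K :=
        calc cE D p (revealedAt Γ D N) (fS Γ D g x) K = ∑ K₂ ∈ D.powerset, wtW D p K₂ * fS Γ D g x K :=
              Finset.sum_congr rfl fun K₂ hK₂ => by rw [(hM K₂ hK₂).1 hx]
          _ = fS Γ D g x K := by rw [← Finset.sum_mul, sum_wtW, one_mul]
      rw [e1, e2]; ring
    · rw [ind_of_mem (show K ∈ {L : Finset V | x ∉ reached Γ D N L} from hx), one_mul]
      have e2 : cE D p (revealedAt Γ D N) (fS Γ D g x) K = ED D p (fS Γ (D \ revealedAt Γ D N K) g x) :=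
        Finset.sum_congr rfl fun K₂ hK₂ => by rw [((hM K₂ hK₂).2.1 hx)]
      by_cases hv : v ∈ reached Γ D N K
      · -- `1{v ↔ S}` is decided, and the world indicator vanishes
        have e1 : cE D p (revealedAt Γ D N) (fun L => fS Γ D g x L * nS Γ D S v L) K =
            nS Γ D S v K * ED D p (fS Γ (D \ revealedAt Γ D N K) g x) := by
          calc cE D p (revealedAt Γ D N) (fun L => fS Γ D g x L * nS Γ D S v L) K
              = cE D p (revealedAt Γ D N) (fun L => nS Γ D S v L * fS Γ D g x L) K := by
                refine Finset.sum_congr rfl fun K₂ _ => ?_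
                show wtW D p K₂ * (fS Γ D g x _ * nS Γ D S v _) = wtW D p K₂ * (nS Γ D S v _ * fS Γ D g x _); ring
            _ = nS Γ D S v K * cE D p (revealedAt Γ D N) (fS Γ D g x) K :=
                cE_mul_of_local_on D p (revealedAt Γ D N) (fun K₂ hK₂ => (hM K₂ hK₂).2.2.1 hv) (fS Γ D g x)
            _ = _ := by rw [e2]
        have e3 : cE D p (revealedAt Γ D N) (nS Γ D S v) K = nS Γ D S v K :=
          calc cE D p (revealedAt Γ D N) (nS Γ D S v) K = ∑ K₂ ∈ D.powerset, wtW D p K₂ * nS Γ D S v K :=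
                Finset.sum_congr rfl fun K₂ hK₂ => by rw [(hM K₂ hK₂).2.2.1 hv]
            _ = nS Γ D S v K := by rw [← Finset.sum_mul, sum_wtW, one_mul]
        have e4 : covS Γ D p g x S v (D \ revealedAt Γ D N K) = 0 := by
          unfold covS
          have z1 : ED D p (fun K₂ => fS Γ (D \ revealedAt Γ D N K) g x K₂ * nS Γ (D \ revealedAt Γ D N K) S v K₂) = 0 :=
            Finset.sum_eq_zero fun K₂ hK₂ => by simp only [(hM K₂ hK₂).2.2.2.2 hv, mul_zero]
          have z2 : ED D p (nS Γ (D \ revealedAt Γ D N K) S v) = 0 :=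
            Finset.sum_eq_zero fun K₂ hK₂ => by simp only [(hM K₂ hK₂).2.2.2.2 hv, mul_zero]
          rw [z1, z2]; ring
        rw [e1, e2, e3, e4]; ring
      · -- both undecided: the world covariance
        have e1 : cE D p (revealedAt Γ D N) (fun L => fS Γ D g x L * nS Γ D S v L) K =
            ED D p (fun K₂ => fS Γ (D \ revealedAt Γ D N K) g x K₂ * nS Γ (D \ revealedAt Γ D N K) S v K₂) :=
          Finset.sum_congr rfl fun K₂ hK₂ => by
            show wtW D p K₂ * (fS Γ D g x _ * nS Γ D S v _) = _
            rw [(hM K₂ hK₂).2.1 hx, (hM K₂ hK₂).2.2.2.1 hv]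
        have e3 : cE D p (revealedAt Γ D N) (nS Γ D S v) K = ED D p (nS Γ (D \ revealedAt Γ D N K) S v) :=
          Finset.sum_congr rfl fun K₂ hK₂ => by rw [(hM K₂ hK₂).2.2.2.1 hv]
        rw [e1, e2, e3]; rfl
  have hC : ED D p (fun K => cE D p (revealedAt Γ D N) (fS Γ D g x) K * cE D p (revealedAt Γ D N) (nS Γ D S v) K) =
      ED D p (fun K => cE D p (revealedAt Γ D N) (fS Γ D g x) K * nS Γ D S v K) := by
    rw [ED_mul_cE_comm D p hSD (cE D p (revealedAt Γ D N) (fS Γ D g x)) (nS Γ D S v)]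
    exact ED_congr_on D p fun K _ => by rw [cE_cE D p (revealedAt Γ D N) hSD (fS Γ D g x) K]
  rw [hY, hC]

/-! ### Lemma (★^H)_site and its corollary `Y^H ≤ H` -/

variable {p}

/-- **Lemma (★^H) for SITE percolation, finitary form** (OURS): for `x ∈ S`, any source set `N`, `g` monotone nonnegative on vertex sets:
`Y^H(N) · P(v ↮ S) ≤ P(v ↮ S, v ↮ N) · H(D)`.  Proof = law of total covariance along the site exploration of `C_N`, Gladkov's decision-tree
Harris inequality for `E[g(C_x) | ℱ_N]` and `{v ↔ S ∪ N}`, and the SITE vdBHK Theorem 1.4 with the set `S`. No hypothesis `v ∉ S`.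
[cite: Gladkov2024, Thm. 3.2 (p. 4)] [cite: VandenbergHaggstromKahn2005, Thm. 1.4 (p. 7), eq. (6) (p. 4)] -/
theorem starS_ED (hp0 : ∀ u, 0 ≤ p u) (hp1 : ∀ u, p u ≤ 1) (hxS : x ∈ S) (hg : Monotone g) (hg0 : ∀ C, 0 ≤ g C) :
    yS Γ D p g x S v N * ED D p (fun K => 1 - nS Γ D S v K) ≤
      ED D p (fun K => (1 - nS Γ D S v K) * (1 - nS Γ D N v K)) * covS Γ D p g x S v D := by
  have hSD : SelfDetermined (revealedAt Γ D N) := selfDetermined_revealedAt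
  have hrev : revealed (ttree (Γ := Γ) D N (D.card + 1) init) = revealedAt Γ D N :=
    funext fun K => (revealedAt_eq_revealed (Γ := Γ) (D := D) (N := N) K).symm
  /- 1.–2. law of total covariance -/
  have hY := yS_eq_sub (Γ := Γ) D p N x v S g
  have hB0 : covS Γ D p g x S v D =
      ED D p (fun K => fS Γ D g x K * nS Γ D S v K) - ED D p (fS Γ D g x) * ED D p (nS Γ D S v) := rfl
  /- 3. decision-tree Harris for `E[g(C_x) | ℱ_N]` and `{v ↔ S ∪ N}`. -/
  have hTH0 := treeHarris_real D hp0 hp1 (ttree (Γ := Γ) D N (D.card + 1) init) (fS_mono (Γ := Γ) D hg x)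
    (fun K => hg0 _) (isUpperSet_nS (Γ := Γ) D (S ∪ N) v)
  rw [hrev, PrW_eq_sum_ind] at hTH0
  have hTH : ED D p (fS Γ D g x) * (ED D p (nS Γ D S v) + ED D p (fun K => (1 - nS Γ D S v K) * nS Γ D N v K)) ≤
      ED D p (fun K => cE D p (revealedAt Γ D N) (fS Γ D g x) K * nS Γ D S v K) +
        ED D p (fun K => cE D p (revealedAt Γ D N) (fS Γ D g x) K * ((1 - nS Γ D S v K) * nS Γ D N v K)) := by
    have eG : ∑ K ∈ D.powerset, wtW D p K * ind {L : Finset V | ∃ s ∈ S ∪ N, s ∈ sC Γ D v (↑L : Set V)} K =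
        ED D p (nS Γ D S v) + ED D p (fun K => (1 - nS Γ D S v K) * nS Γ D N v K) := by
      rw [← ED_add]
      exact Finset.sum_congr rfl fun K _ => by
        show wtW D p K * _ = wtW D p K * (nS Γ D S v K + (1 - nS Γ D S v K) * nS Γ D N v K)
        rw [← nS_union_eq]; rfl
    have eR : ED D p (fun K => cE D p (revealedAt Γ D N) (fS Γ D g x) K *
        ind {L : Finset V | ∃ s ∈ S ∪ N, s ∈ sC Γ D v (↑L : Set V)} K) =
        ED D p (fun K => cE D p (revealedAt Γ D N) (fS Γ D g x) K * nS Γ D S v K) +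
          ED D p (fun K => cE D p (revealedAt Γ D N) (fS Γ D g x) K * ((1 - nS Γ D S v K) * nS Γ D N v K)) := by
      rw [← ED_add]
      exact ED_congr_on D p fun K _ => by
        show _ = cE D p (revealedAt Γ D N) (fS Γ D g x) K * nS Γ D S v K +
          cE D p (revealedAt Γ D N) (fS Γ D g x) K * ((1 - nS Γ D S v K) * nS Γ D N v K)
        rw [show ind {L : Finset V | ∃ s ∈ S ∪ N, s ∈ sC Γ D v (↑L : Set V)} K = nS Γ D (S ∪ N) v K from rfl,
          nS_union_eq]; ring
    rw [← eG, ← eR]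
    exact hTH0
  /- 4. `Z = 1{v↮S}·1{v↔N}` is decided by the exploration. -/
  have hZloc : ∀ K ∈ D.powerset, ∀ K₂ ∈ D.powerset,
      (1 - nS Γ D S v (splice (revealedAt Γ D N K) K K₂)) * nS Γ D N v (splice (revealedAt Γ D N K) K K₂) =
        (1 - nS Γ D S v K) * nS Γ D N v K := by
    intro K _ K₂ _
    have hn : nS Γ D N v (splice (revealedAt Γ D N K) K K₂) = nS Γ D N v K := by
      rw [nS_eq_ind_reached, nS_eq_ind_reached]
      refine BystanderBHK.ind_congr ?_
      simp only [Set.mem_setOf_eq, reached_splice]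
    rw [hn]
    by_cases hv : v ∈ reached Γ D N K
    · rw [(starS_markov (Γ := Γ) x v S g K K₂).2.2.1 hv]
    · rw [show nS Γ D N v K = 0 from by rw [nS_eq_ind_reached]; exact ind_of_not_mem hv, mul_zero, mul_zero]
  have hEZ : ED D p (fun K => cE D p (revealedAt Γ D N) (fS Γ D g x) K * ((1 - nS Γ D S v K) * nS Γ D N v K)) =
      ED D p (fun K => fS Γ D g x K * ((1 - nS Γ D S v K) * nS Γ D N v K)) := by
    calc ED D p (fun K => cE D p (revealedAt Γ D N) (fS Γ D g x) K * ((1 - nS Γ D S v K) * nS Γ D N v K))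
        = ED D p (cE D p (revealedAt Γ D N) (fun L => ((1 - nS Γ D S v L) * nS Γ D N v L) * fS Γ D g x L)) :=
          ED_congr_on D p fun K hK => by
            rw [cE_mul_of_local_on D p (revealedAt Γ D N) (fun K₂ hK₂ => hZloc K hK K₂ hK₂) (fS Γ D g x)]; ring
      _ = ED D p (fun L => ((1 - nS Γ D S v L) * nS Γ D N v L) * fS Γ D g x L) := ED_cE D p hSD _
      _ = ED D p (fun K => fS Γ D g x K * ((1 - nS Γ D S v K) * nS Γ D N v K)) := ED_congr_on D p fun K _ => by
          show (1 - nS Γ D S v K) * nS Γ D N v K * fS Γ D g x K = fS Γ D g x K * ((1 - nS Γ D S v K) * nS Γ D N v K); ring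
  /- 5. site BHK 1.4 with the set `S`, and the constants. -/
  have hG := bhk14S_ED (Γ := Γ) D hp0 hp1 N x v S hxS g hg
  have hP : ED D p (fun K => 1 - nS Γ D S v K) = 1 - ED D p (nS Γ D S v) := by
    have h := ED_sub D p (fun _ => (1 : ℝ)) (nS Γ D S v)
    have h1 : ED D p (fun _ => (1 : ℝ)) = 1 := by unfold ED; rw [← Finset.sum_mul, sum_wtW, one_mul]
    rw [h1] at h
    exact h
  have hQ : ED D p (fun K => (1 - nS Γ D S v K) * (1 - nS Γ D N v K)) =
      ED D p (fun K => 1 - nS Γ D S v K) - ED D p (fun K => (1 - nS Γ D S v K) * nS Γ D N v K) := by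
    rw [← ED_sub]
    exact ED_congr_on D p fun K _ => by
      show (1 - nS Γ D S v K) * (1 - nS Γ D N v K) = (1 - nS Γ D S v K) - (1 - nS Γ D S v K) * nS Γ D N v K; ring
  have hFh : ED D p (fun K => fS Γ D g x K * (1 - nS Γ D S v K)) =
      ED D p (fS Γ D g x) - ED D p (fun K => fS Γ D g x K * nS Γ D S v K) := by
    rw [← ED_sub]
    exact ED_congr_on D p fun K _ => by
      show fS Γ D g x K * (1 - nS Γ D S v K) = fS Γ D g x K - fS Γ D g x K * nS Γ D S v K; ring
  have hP0 : 0 ≤ ED D p (fun K => 1 - nS Γ D S v K) :=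
    Finset.sum_nonneg fun K _ => mul_nonneg (wtW_nonneg D hp0 hp1 K) (by linarith [(nS_nonneg_le_one (Γ := Γ) D S v K).2])
  /- 6. assembly. -/
  set Efh := ED D p (fun K => fS Γ D g x K * nS Γ D S v K) with hEfh
  set Ef := ED D p (fS Γ D g x) with hEf'
  set Eh := ED D p (nS Γ D S v) with hEh'
  set Cgh := ED D p (fun K => cE D p (revealedAt Γ D N) (fS Γ D g x) K * nS Γ D S v K) with hCgh
  set EZ := ED D p (fun K => (1 - nS Γ D S v K) * nS Γ D N v K) with hEZ'
  set EfZ := ED D p (fun K => fS Γ D g x K * ((1 - nS Γ D S v K) * nS Γ D N v K)) with hEfZ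
  rw [hEZ] at hTH
  rw [hP, hFh] at hG
  rw [hY, hQ, hP, hB0]
  have h1 : (1 - Eh) * (Ef * EZ - EfZ) ≤ (1 - Eh) * (Cgh - Ef * Eh) := by
    rw [hP] at hP0
    exact mul_le_mul_of_nonneg_left (by linarith) hP0
  have key : (1 - Eh - EZ) * (Efh - Ef * Eh) - (Efh - Cgh) * (1 - Eh) =
      ((1 - Eh) * (Cgh - Ef * Eh) - (1 - Eh) * (Ef * EZ - EfZ)) + (EZ * (Ef - Efh) - (1 - Eh) * EfZ) := by ring
  nlinarith [h1, hG, key]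

omit [Fintype V] in
/-- **`Y^H(N) ≤ H(D)` for SITE percolation** (OURS): `H − Y^H(N) = Cov(E[g(C_x) | ℱ_N], 1{v ↔ S}) ≥ 0` by the decision-tree Harris inequality
alone. [cite: Gladkov2024, Thm. 3.2 (p. 4)] -/
theorem yS_le_covS (hp0 : ∀ u, 0 ≤ p u) (hp1 : ∀ u, p u ≤ 1) (hg : Monotone g) (hg0 : ∀ C, 0 ≤ g C) :
    yS Γ D p g x S v N ≤ covS Γ D p g x S v D := by
  have hrev : revealed (ttree (Γ := Γ) D N (D.card + 1) init) = revealedAt Γ D N :=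
    funext fun K => (revealedAt_eq_revealed (Γ := Γ) (D := D) (N := N) K).symm
  have hY := yS_eq_sub (Γ := Γ) D p N x v S g
  have hTH := treeHarris_real D hp0 hp1 (ttree (Γ := Γ) D N (D.card + 1) init) (fS_mono (Γ := Γ) D hg x)
    (fun K => hg0 _) (isUpperSet_nS (Γ := Γ) D S v)
  rw [hrev, PrW_eq_sum_ind] at hTH
  change ED D p (fS Γ D g x) * ED D p (nS Γ D S v) ≤
    ED D p (fun K => cE D p (revealedAt Γ D N) (fS Γ D g x) K * nS Γ D S v K) at hTH
  have hB0 : covS Γ D p g x S v D =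
      ED D p (fun K => fS Γ D g x K * nS Γ D S v K) - ED D p (fS Γ D g x) * ED D p (nS Γ D S v) := rfl
  rw [hY, hB0]
  linarith

end Main

end SiteStarH

end Summit.CriticalPhenomena.PercolationContinuityZ3.Theorems.Transplant
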